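import Summits.Parity.GeneralizedHardyLittlewood.Theorems.LiouvilleShiftedTablesTypeI2DilatedAssemble5

/-!
# THE ASSEMBLY of the line `peel-to-drappeau` for the crux `TypeI2Dilated` (stmt-Parity-14272)

Part 6/6: the registered stub `stub_assembleFrom : AssembleFrom` (Step 7, numerics).

Route `LiouvilleShiftedTables` (Parity / GeneralizedHardyLittlewood); registered skeleton
`Cruxes/TypeI2Dilated/Lines/peel-to-drappeau.lean` (v6), stub `stub_assembleFrom : AssembleFrom` where
`AssembleFrom := URBound → (DilatedTypeII → DilatedMainTerms → DilatedDivisorAP → BVLiouville → TypeI2Dilated)`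
(vocabulary in `Summits.Parity.GeneralizedHardyLittlewood.Theorems.LiouvilleShiftedTablesDefs`).  The paper proof with constants and the audit of the four inputs is the
second module docstring of part 5. [this line: Lines/peel-to-drappeau.md]
-/

noncomputable section

namespace Summit.Parity.GeneralizedHardyLittlewood.Cruxes.TypeI2Dilated.PeelToDrappeau

open Finset Real
open scoped ArithmeticFunction.sigma Classical
open Literature.NumberTheory.Sieve Literature.NumberTheory.Sieve.Drappeau2017
  Literature.NumberTheory.Sieve.FouvryTenenbaum2021 Literature.NumberTheory.Sieve.DispersionAssembly
open Summit.Parity.GeneralizedHardyLittlewood.Theses.LiouvilleShiftedTables (TypeI2Dilated BVLiouville)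

/-- **THE ASSEMBLY** (registered stub `stub_assembleFrom : AssembleFrom`, skeleton v6):
`URBound → (DilatedTypeII → DilatedMainTerms → DilatedDivisorAP → BVLiouville → TypeI2Dilated)` (Step 7).
[this line] -/
theorem stub_assembleFrom : AssembleFrom := by
  intro hU hII hMT hDAP hBV
  rw [show Summit.Parity.GeneralizedHardyLittlewood.Theses.LiouvilleShiftedTables.TypeI2Dilated ↔ _ from
    Negative.typeI2Dilated_iff, Negative.typeI2DilatedFor_iff_boundAt]
  intro c hc
  obtain ⟨ρ₀, hρ₀, hMT'⟩ := hMT c hc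
  obtain ⟨ρ₁, hρ₁, hUR⟩ := hU hII hDAP c hc
  obtain ⟨C₄, hC₄, hTail⟩ := tail_bound hc
  -- the exponent of the crux
  set ρ : ℝ := min (ρ₀ / 40) (min ρ₁ (1 / 100)) with hρdef
  have hρpos : 0 < ρ := lt_min (by positivity) (lt_min hρ₁ (by norm_num))
  have hρ40 : 40 * ρ ≤ ρ₀ := by
    have : ρ ≤ ρ₀ / 40 := min_le_left _ _
    linarith
  have hρ1 : ρ ≤ ρ₁ := (min_le_right _ _).trans (min_le_left _ _)
  have hρ100 : ρ ≤ 1 / 100 := (min_le_right _ _).trans (min_le_right _ _)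
  refine ⟨ρ, hρpos, fun A hA => ?_⟩
  obtain ⟨C₁, x₁, hBVb⟩ := bvRange_bound hBV c hρpos (by linarith) (A := A + 1) (by linarith)
  obtain ⟨C₂, x₂, hMTb⟩ := hMT' (4 * ρ) (by positivity) (by linarith) (A + 1) (by linarith)
  obtain ⟨C₃, x₃, hURb⟩ := hUR ρ hρpos hρ1
  obtain ⟨X₅, hX₅⟩ := Negative.exists_log_rpow_le (A + 18) (s := ρ / 2) (K := 1) (by positivity) one_pos
  -- constants
  refine ⟨|C₁| + |C₂| + ((c.natAbs : ℝ) + 1) + 4 * C₄ + C₄ + 2 * max C₃ 0,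
    max (max (max x₁ x₂) (max x₃ X₅)) (max (max 3 ((c.natAbs : ℝ) + 1)) ((2 : ℝ) ^ ρ⁻¹)), ?_⟩
  intro x hx w R S y hR1 hRx hS0 hSR hy0 hyx
  -- unpacking `x ≥ x₀`
  have hxA : max (max x₁ x₂) (max x₃ X₅) ≤ x := (le_max_left _ _).trans hx
  have hxB : max (max 3 ((c.natAbs : ℝ) + 1)) ((2 : ℝ) ^ ρ⁻¹) ≤ x := (le_max_right _ _).trans hx
  have hxx₁ : x₁ ≤ x := ((le_max_left _ _).trans (le_max_left _ _)).trans hxA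
  have hxx₂ : x₂ ≤ x := ((le_max_right _ _).trans (le_max_left _ _)).trans hxA
  have hxx₃ : x₃ ≤ x := ((le_max_left _ _).trans (le_max_right _ _)).trans hxA
  have hxX₅ : X₅ ≤ x := ((le_max_right _ _).trans (le_max_right _ _)).trans hxA
  have hx3 : 3 ≤ x := ((le_max_left _ _).trans (le_max_left _ _)).trans hxB
  have hxc : (c.natAbs : ℝ) + 1 ≤ x := ((le_max_right _ _).trans (le_max_left _ _)).trans hxB
  have hx2ρ : (2 : ℝ) ^ ρ⁻¹ ≤ x := (le_max_right _ _).trans hxB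
  have hx1 : 1 ≤ x := by linarith
  have hx0 : 0 < x := by linarith
  have hL1 : 1 ≤ Real.log x := log_one_le_of_three_le hx3
  have hL0 : 0 < Real.log x := by linarith
  have hxpow : ∀ a b : ℝ, x ^ a * x ^ b = x ^ (a + b) := fun a b => (Real.rpow_add hx0 a b).symm
  have hxle : ∀ a b : ℝ, a ≤ b → x ^ a ≤ x ^ b := fun a b h => Real.rpow_le_rpow_of_exponent_le hx1 h
  have hx1' : x = x ^ (1 : ℝ) := (Real.rpow_one x).symm
  -- `x^ρ ≥ 2`
  have hxρ2 : 2 ≤ x ^ ρ := by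
    calc (2 : ℝ) = ((2 : ℝ) ^ ρ⁻¹) ^ ρ := (Real.rpow_inv_rpow (by norm_num) hρpos.ne').symm
      _ ≤ x ^ ρ := Real.rpow_le_rpow (by positivity) hx2ρ hρpos.le
  -- the key threshold `L^{A+18} ≤ x^{ρ/2}`
  have hLA : Real.log x ^ (A + 18) ≤ x ^ (ρ / 2) := by simpa using hX₅ x hxX₅
  -- parameters
  set Q : ℕ := ⌊x ^ ρ⌋₊ with hQdef
  set T₀ : ℝ := x ^ (1 / 2 - 4 * ρ) with hT₀def
  have hT₀pos : 0 < T₀ := Real.rpow_pos_of_pos hx0 _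
  obtain ⟨J, hJ1, hJ2, hJ3⟩ := exists_dyadic_cut (S := S) hT₀pos
  set Pm : ℕ := ⌊x ^ (3 * ρ)⌋₊ with hPmdef
  set Rd : ℝ := x ^ (40 * ρ) with hRddef
  have h2J : (1 : ℝ) ≤ 2 ^ J := one_le_pow₀ (by norm_num)
  -- basic size facts
  have hR0 : 0 ≤ R := by linarith
  have hρx : x ^ ρ ≤ x := by simpa [← hx1'] using hxle ρ 1 (by linarith)
  have hRx1 : R ≤ x := hRx.trans hρx
  have hSRx : S ≤ x ^ (1 / 2 + ρ) := by
    calc S = S * 1 := (mul_one S).symm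
      _ ≤ S * R := mul_le_mul_of_nonneg_left hR1 hS0
      _ ≤ x ^ (1 / 2 + ρ) := hSR
  have hSx : S ≤ x := hSRx.trans (by simpa [← hx1'] using hxle (1 / 2 + ρ) 1 (by linarith))
  have hQle : (Q : ℝ) ≤ x ^ ρ := Nat.floor_le (by positivity)
  have hQx : (Q : ℝ) ≤ x := hQle.trans hρx
  have hPmle : (Pm : ℝ) ≤ x ^ (3 * ρ) := Nat.floor_le (by positivity)
  have hx3ρ2 : 2 ≤ x ^ (3 * ρ) := hxρ2.trans (hxle _ _ (by linarith))
  have hPm1 : 1 ≤ Pm := Nat.le_floor (by simpa using (by linarith : (1 : ℝ) ≤ x ^ (3 * ρ)))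
  have hPmge : x ^ (3 * ρ) / 2 ≤ Pm := by
    have := Nat.sub_one_lt_floor (x ^ (3 * ρ))
    rw [← hPmdef] at this
    linarith
  have hYx : y + (c : ℝ) ≤ 2 * x := by
    have h' : (c : ℝ) ≤ ((c.natAbs : ℤ) : ℝ) := Int.cast_le.mpr Int.le_natAbs
    rw [Int.cast_natCast] at h'
    linarith
  have hPmR : (Pm : ℝ) * R ≤ x ^ (4 * ρ) := by
    calc (Pm : ℝ) * R ≤ x ^ (3 * ρ) * x ^ ρ := mul_le_mul hPmle hRx hR0 (by positivity)
      _ = x ^ (4 * ρ) := by rw [hxpow]; ring_nf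
  -- Steps 1–4
  have hP := lhs_le_pieces hc Q w R y hS0 J Pm Rd
  -- Step 2: the BV range
  have hQRS : (Q : ℝ) * R * (S / 2 ^ J) ≤ x ^ (1 / 2 - ρ) := by
    calc (Q : ℝ) * R * (S / 2 ^ J) ≤ x ^ ρ * x ^ ρ * (2 * T₀) := by
          apply mul_le_mul (mul_le_mul hQle hRx hR0 (by positivity)) hJ1 (by positivity) (by positivity)
      _ = 2 * (x ^ (-ρ) * x ^ (1 / 2 - ρ)) := by
          rw [hT₀def, hxpow, mul_comm, mul_assoc, hxpow, hxpow]; ring_nf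
      _ ≤ 1 * x ^ (1 / 2 - ρ) := by
          rw [← mul_assoc]
          refine mul_le_mul_of_nonneg_right ?_ (by positivity)
          rw [Real.rpow_neg hx0.le]
          have : (0 : ℝ) < x ^ ρ := by positivity
          rw [mul_inv_le_iff₀ this]
          linarith
      _ = x ^ (1 / 2 - ρ) := one_mul _
  have h2 := hBVb x hxx₁ w Q R (S / 2 ^ J) y hy0 hyx hQRS
  -- (i) the correction terms
  have hi : ((c.natAbs : ℝ) + 1) * ((Q : ℝ) * ⌊R⌋₊ * ⌊S⌋₊) ≤ ((c.natAbs : ℝ) + 1) * x ^ (1 / 2 + 2 * ρ) := by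
    refine mul_le_mul_of_nonneg_left ?_ (by positivity)
    calc (Q : ℝ) * ⌊R⌋₊ * ⌊S⌋₊ ≤ x ^ ρ * R * S := by
          refine mul_le_mul (mul_le_mul hQle (Nat.floor_le hR0) (by positivity) (by positivity))
            (Nat.floor_le hS0) (by positivity) (by positivity)
      _ = x ^ ρ * (S * R) := by ring
      _ ≤ x ^ ρ * x ^ (1 / 2 + ρ) := mul_le_mul_of_nonneg_left hSR (by positivity)
      _ = x ^ (1 / 2 + 2 * ρ) := by rw [hxpow]; ring_nf
  -- (ii) the tail
  have hii : ∑ q ∈ Icc 1 Q, ∑ r ∈ Icc 1 ⌊R⌋₊,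
      ∑ s ∈ (Icc 1 ⌊S⌋₊).filter (fun s : ℕ => Pm < smoothComponent (q * r * c.natAbs) s),
        (max (y + c) 0 / ((r : ℝ) * s) + 1) ≤
      4 * C₄ * (x ^ (1 - ρ / 2) * Real.log x ^ (17 : ℝ)) +
        C₄ * (x ^ (1 - (1 / 2 - 2 * ρ)) * Real.log x ^ (1 : ℝ)) := by
    have hY0 : 0 ≤ max (y + (c : ℝ)) 0 := le_max_right _ _
    have hY2 : max (y + (c : ℝ)) 0 ≤ 2 * x := max_le hYx (by positivity)
    have ht := hTail x hx3 Q Pm hPm1 hQx R S (max (y + c) 0) hR0 hRx1 hS0 hSx hY0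
    refine ht.trans ?_
    rw [mul_add]
    refine add_le_add ?_ ?_
    · -- `Q Y⁺ Pm^{-1/2} L^17 ≤ 4 x^{1-ρ/2} L^17`
      have hPm_half : (Pm : ℝ) ^ (-(1 / 2 : ℝ)) ≤ 2 * x ^ (-(3 * ρ / 2)) := by
        have hpos : 0 < x ^ (3 * ρ) / 2 := by positivity
        have hhalf : (1 / 2 : ℝ) ≤ (2 : ℝ) ^ (-(1 / 2 : ℝ)) := by
          rw [Real.rpow_neg (by norm_num), ← Real.sqrt_eq_rpow, one_div,
            inv_le_inv₀ (by positivity) (by norm_num), Real.sqrt_le_left (by norm_num)]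
          norm_num
        calc (Pm : ℝ) ^ (-(1 / 2 : ℝ)) ≤ (x ^ (3 * ρ) / 2) ^ (-(1 / 2 : ℝ)) :=
              Real.rpow_le_rpow_of_nonpos hpos hPmge (by norm_num)
          _ = (x ^ (3 * ρ)) ^ (-(1 / 2 : ℝ)) / (2 : ℝ) ^ (-(1 / 2 : ℝ)) :=
              Real.div_rpow (by positivity) (by norm_num) _
          _ = x ^ (-(3 * ρ / 2)) / (2 : ℝ) ^ (-(1 / 2 : ℝ)) := by
              rw [← Real.rpow_mul hx0.le]; ring_nf
          _ ≤ x ^ (-(3 * ρ / 2)) / (1 / 2) :=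
              div_le_div_of_nonneg_left (by positivity) (by norm_num) hhalf
          _ = 2 * x ^ (-(3 * ρ / 2)) := by ring
      calc C₄ * ((Q : ℝ) * max (y + c) 0 * (Pm : ℝ) ^ (-(1 / 2 : ℝ)) * Real.log x ^ (17 : ℕ))
          ≤ C₄ * (x ^ ρ * (2 * x) * (2 * x ^ (-(3 * ρ / 2))) * Real.log x ^ (17 : ℕ)) := by
            gcongr
        _ = 4 * C₄ * ((x ^ ρ * x * x ^ (-(3 * ρ / 2))) * Real.log x ^ (17 : ℕ)) := by ring
        _ = 4 * C₄ * (x ^ (1 - ρ / 2) * Real.log x ^ (17 : ℝ)) := by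
            congr 2
            · nth_rewrite 2 [hx1']
              rw [hxpow, hxpow]; ring_nf
            · exact_mod_cast (Real.rpow_natCast (Real.log x) 17).symm
    · calc C₄ * ((Q : ℝ) * R * S * Real.log x) = C₄ * ((Q : ℝ) * (S * R) * Real.log x) := by ring
        _ ≤ C₄ * (x ^ ρ * x ^ (1 / 2 + ρ) * Real.log x) := by gcongr
        _ = C₄ * (x ^ (1 - (1 / 2 - 2 * ρ)) * Real.log x ^ (1 : ℝ)) := by
            rw [hxpow, Real.rpow_one]; ring_nf
  -- (iii) the main terms
  have hiii : ∑ P ∈ Icc 1 Pm, ∑ q ∈ Icc 1 Q, ∑ r ∈ Icc 1 ⌊R⌋₊,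
      ‖∑ t ∈ sRange c q (r * P) (S / 2 ^ J / P) (S / P), mainPiece c q w (r * P) t (y + c) Rd‖ ≤
      C₂ * x / Real.log x ^ (A + 1) := by
    have hM : ∑ P ∈ Icc 1 Pm, ∑ q ∈ Icc 1 ⌊x ^ (4 * ρ)⌋₊, ∑ r ∈ Icc 1 ⌊R⌋₊,
        ‖∑ t ∈ sRange c q (r * P) (S / 2 ^ J / P) (S / P), mainPiece c q w (r * P) t (y + c) Rd‖ ≤
        C₂ * x / Real.log x ^ (A + 1) :=
      hMTb x hxx₂ (fun _ => c) (fun _ => (w : ℤ) + c) (y + c) R (S / 2 ^ J) S Rd Pm hYx hPmR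
        (hSR.trans (hxle _ _ (by linarith)))
        (Real.one_le_rpow hx1 (by positivity)) (hxle _ _ hρ40)
    have hQ4 : Q ≤ ⌊x ^ (4 * ρ)⌋₊ := Nat.floor_mono (hxle _ _ (by linarith))
    refine le_trans (Finset.sum_le_sum fun P _ => ?_) hM
    exact Finset.sum_le_sum_of_subset_of_nonneg (Finset.Icc_subset_Icc le_rfl hQ4)
      fun _ _ _ => Finset.sum_nonneg fun _ _ => norm_nonneg _
  -- (iv) the `𝔲_R` terms
  have h2Jx : (2 : ℝ) ^ J ≤ x := by
    refine hJ3.trans (max_le hx1 ?_)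
    rw [div_le_iff₀ hT₀pos]
    calc S ≤ x ^ (1 / 2 + ρ) := hSRx
      _ ≤ x ^ (1 / 2 + ρ) * T₀ := le_mul_of_one_le_right (by positivity) (Real.one_le_rpow hx1 (by linarith))
      _ ≤ x * T₀ := by
          refine mul_le_mul_of_nonneg_right ?_ hT₀pos.le
          simpa [← hx1'] using hxle (1 / 2 + ρ) 1 (by linarith)
  have hJL : (J : ℝ) ≤ 2 * Real.log x := by
    have hlog := Real.log_le_log (by positivity) h2Jx
    rw [Real.log_pow] at hlog
    have hl2 : (1 / 2 : ℝ) ≤ Real.log 2 := by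
      have := Real.log_two_gt_d9; linarith
    have : (J : ℝ) * (1 / 2) ≤ (J : ℝ) * Real.log 2 := mul_le_mul_of_nonneg_left hl2 (Nat.cast_nonneg J)
    linarith
  have hiv : ∑ P ∈ Icc 1 Pm, ∑ j ∈ Finset.range J, ∑ q ∈ Icc 1 Q, ∑ r ∈ Icc 1 ⌊R⌋₊,
      ‖∑ t ∈ sRange c q (r * P) (S / 2 ^ (j + 1) / P) (2 * (S / 2 ^ (j + 1) / P)),
        uRPiece c q w (r * P) t (y + c) Rd‖ ≤
      2 * max C₃ 0 * (x ^ (1 - 2 * ρ) * Real.log x ^ (1 : ℝ)) := by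
    have hblock : ∀ P ∈ Icc 1 Pm, ∀ j ∈ Finset.range J,
        ∑ q ∈ Icc 1 Q, ∑ r ∈ Icc 1 ⌊R⌋₊,
          ‖∑ t ∈ sRange c q (r * P) (S / 2 ^ (j + 1) / P) (2 * (S / 2 ^ (j + 1) / P)),
            uRPiece c q w (r * P) t (y + c) Rd‖ ≤ max C₃ 0 * x ^ (1 - 5 * ρ) := by
      intro P hP j hj
      rw [Finset.mem_Icc] at hP
      rw [Finset.mem_range] at hj
      have hP0 : (0 : ℝ) < P := by exact_mod_cast hP.1
      have hPPm : (P : ℝ) ≤ Pm := by exact_mod_cast hP.2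
      -- the block is in the dispersion range: `J ≥ 1`, so `T₀ < S/2^J ≤ S/2^(j+1)`
      have hJpos : T₀ < S / 2 ^ J := by
        rcases hJ2 with h0 | h0
        · omega
        · exact h0
      have hSlo : x ^ (1 / 2 - 9 * ρ) ≤ S / 2 ^ (j + 1) / P := by
        have hjJ : S / 2 ^ J ≤ S / 2 ^ (j + 1) := by
          apply div_le_div_of_nonneg_left hS0 (by positivity)
          exact pow_le_pow_right₀ (by norm_num) (by omega)
        rw [le_div_iff₀ hP0]
        calc x ^ (1 / 2 - 9 * ρ) * P ≤ x ^ (1 / 2 - 7 * ρ) * x ^ (3 * ρ) := by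
              refine mul_le_mul (hxle _ _ (by linarith)) (hPPm.trans hPmle) hP0.le (by positivity)
          _ = T₀ := by rw [hT₀def, hxpow]; ring_nf
          _ ≤ S / 2 ^ (j + 1) := (hJpos.le.trans hjJ)
      have hwin : 2 * (S / 2 ^ (j + 1) / P) * R * P ≤ x ^ (1 / 2 + ρ) := by
        have e : 2 * (S / 2 ^ (j + 1) / P) * R * P = S * R / 2 ^ j := by
          field_simp
          ring
        rw [e]
        exact (div_le_self (by positivity) (one_le_pow₀ (by norm_num))).trans hSR
      have hPR : (P : ℝ) * R ≤ x ^ (4 * ρ) :=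
        le_trans (mul_le_mul_of_nonneg_right hPPm hR0) hPmR
      have hu := hURb x hxx₃ w (y + c) R (S / 2 ^ (j + 1) / P) P hP.1 hYx hPR hSlo hwin
      exact hu.trans (mul_le_mul_of_nonneg_right (le_max_left _ _) (by positivity))
    calc ∑ P ∈ Icc 1 Pm, ∑ j ∈ Finset.range J, ∑ q ∈ Icc 1 Q, ∑ r ∈ Icc 1 ⌊R⌋₊,
          ‖∑ t ∈ sRange c q (r * P) (S / 2 ^ (j + 1) / P) (2 * (S / 2 ^ (j + 1) / P)),
            uRPiece c q w (r * P) t (y + c) Rd‖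
        ≤ ∑ P ∈ Icc 1 Pm, ∑ _j ∈ Finset.range J, max C₃ 0 * x ^ (1 - 5 * ρ) :=
          Finset.sum_le_sum fun P hP => Finset.sum_le_sum fun j hj => hblock P hP j hj
      _ = (Pm : ℝ) * J * (max C₃ 0 * x ^ (1 - 5 * ρ)) := by
          simp only [Finset.sum_const, Finset.card_range, Nat.card_Icc, add_tsub_cancel_right,
            nsmul_eq_mul]; ring
      _ ≤ x ^ (3 * ρ) * (2 * Real.log x) * (max C₃ 0 * x ^ (1 - 5 * ρ)) := by
          gcongr
      _ = 2 * max C₃ 0 * (x ^ (1 - 2 * ρ) * Real.log x ^ (1 : ℝ)) := by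
          rw [Real.rpow_one, mul_comm (x ^ (3 * ρ)) (2 * Real.log x)]
          have : x ^ (3 * ρ) * x ^ (1 - 5 * ρ) = x ^ (1 - 2 * ρ) := by rw [hxpow]; ring_nf
          calc 2 * Real.log x * x ^ (3 * ρ) * (max C₃ 0 * x ^ (1 - 5 * ρ))
              = 2 * max C₃ 0 * ((x ^ (3 * ρ) * x ^ (1 - 5 * ρ)) * Real.log x) := by ring
            _ = _ := by rw [this]
  -- Step 7: numerics
  have hn1 : C₁ * x / Real.log x ^ (A + 1) ≤ |C₁| * (x / Real.log x ^ A) :=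
    mul_div_log_rpow_succ_le C₁ A hx0.le hL1
  have hn3 : C₂ * x / Real.log x ^ (A + 1) ≤ |C₂| * (x / Real.log x ^ A) :=
    mul_div_log_rpow_succ_le C₂ A hx0.le hL1
  have hn2 : x ^ (1 / 2 + 2 * ρ) ≤ x / Real.log x ^ A := by
    have h := rpow_one_sub_mul_log_rpow_le (A := A) (B := 0) (κ := 1 / 2 - 2 * ρ) hx0 hL0
      (log_rpow_threshold_mono hx1 hL1 (by norm_num) (by linarith) hLA)
    rw [Real.rpow_zero, mul_one] at h
    have e : (1 : ℝ) - (1 / 2 - 2 * ρ) = 1 / 2 + 2 * ρ := by ring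
    rwa [e] at h
  have hn4 : x ^ (1 - ρ / 2) * Real.log x ^ (17 : ℝ) ≤ x / Real.log x ^ A :=
    rpow_one_sub_mul_log_rpow_le hx0 hL0 (log_rpow_threshold_mono hx1 hL1 (by norm_num) le_rfl hLA)
  have hn5 : x ^ (1 - (1 / 2 - 2 * ρ)) * Real.log x ^ (1 : ℝ) ≤ x / Real.log x ^ A :=
    rpow_one_sub_mul_log_rpow_le hx0 hL0 (log_rpow_threshold_mono hx1 hL1 (by norm_num) (by linarith) hLA)
  have hn6 : x ^ (1 - 2 * ρ) * Real.log x ^ (1 : ℝ) ≤ x / Real.log x ^ A :=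
    rpow_one_sub_mul_log_rpow_le hx0 hL0 (log_rpow_threshold_mono hx1 hL1 (by norm_num) (by linarith) hLA)
  have hC3 : 0 ≤ max C₃ 0 := le_max_right _ _
  have hcpos : 0 ≤ (c.natAbs : ℝ) + 1 := by positivity
  have hfin : C₁ * x / Real.log x ^ (A + 1) + ((c.natAbs : ℝ) + 1) * x ^ (1 / 2 + 2 * ρ) +
      (4 * C₄ * (x ^ (1 - ρ / 2) * Real.log x ^ (17 : ℝ)) +
        C₄ * (x ^ (1 - (1 / 2 - 2 * ρ)) * Real.log x ^ (1 : ℝ))) +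
      C₂ * x / Real.log x ^ (A + 1) + 2 * max C₃ 0 * (x ^ (1 - 2 * ρ) * Real.log x ^ (1 : ℝ)) ≤
      |C₁| * (x / Real.log x ^ A) + ((c.natAbs : ℝ) + 1) * (x / Real.log x ^ A) +
      (4 * C₄ * (x / Real.log x ^ A) + C₄ * (x / Real.log x ^ A)) + |C₂| * (x / Real.log x ^ A) +
      2 * max C₃ 0 * (x / Real.log x ^ A) := by
    have h2' := mul_le_mul_of_nonneg_left hn2 hcpos
    have h4' := mul_le_mul_of_nonneg_left hn4 (by positivity : (0 : ℝ) ≤ 4 * C₄)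
    have h5' := mul_le_mul_of_nonneg_left hn5 hC₄.le
    have h6' := mul_le_mul_of_nonneg_left hn6 (by positivity : (0 : ℝ) ≤ 2 * max C₃ 0)
    linarith
  have hK : |C₁| * (x / Real.log x ^ A) + ((c.natAbs : ℝ) + 1) * (x / Real.log x ^ A) +
      (4 * C₄ * (x / Real.log x ^ A) + C₄ * (x / Real.log x ^ A)) + |C₂| * (x / Real.log x ^ A) +
      2 * max C₃ 0 * (x / Real.log x ^ A) =
      (|C₁| + |C₂| + ((c.natAbs : ℝ) + 1) + 4 * C₄ + C₄ + 2 * max C₃ 0) * x / Real.log x ^ A := by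
    ring
  linarith [hP, h2, hi, hii, hiii, hiv, hfin, hK]

end Summit.Parity.GeneralizedHardyLittlewood.Cruxes.TypeI2Dilated.PeelToDrappeau

end
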